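import Summits.QuantumFields.BalabanUV.T4Continuum.Spine.NE2.ComposedAveragingRate

/-!
# T⁴ programme, spine node NE2 (U1a) — R14 W3 (lite): [B7] (124)'s REMAINDER `Q″(V₀)` AS A DISPLAYED `AveragingLaws` DATUM ADDED TO THE COMPOSED TABLE's TRANSPORT ERROR
# (cell `pub-balaban-gaps`, seat ne2 gen 4; plan `run/shared/lean/pub/pub-balaban-gaps/ne/NE2-R14-PLAN.md` W3)

Print's one-step linearised averaging [B7] (124) p. 36 is `Q(V₀) = Q₀(V₀) + Q″(V₀)`: the MAIN TERM (125) (the transported line-sum, composed over the levels = `CovariantTableBalaban.TBal`,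
W2) plus a REMAINDER built from the functions `g(−z), g⁻¹(z), e^{iz}` of the background, which print carries only as a DOMINATED operator: p. 39 (139)–(140)
«`|Q″(V₀)A| ≤ C₁L²α₀·Q″|A|`, `(Q″A)_c = Σ_{b⊂B(c₋)∪B(c₊)} L^{−d}|A_b|`», with compositions bounded by induction ((141)–(143)).  In the tree's currency the composed full averaging is therefore
`√(n_k^d)·Q_k^{full} = B_k + E_k(T_Bal) + E″_k` with `E″_k` an operator family about which only SIZE and TWO-LEVEL CONSISTENCY are asked — a `GramPerturbationLaw.AveragingLaws` datum.
THIS FILE (no new estimate; bookkeeping):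
 * **`averagingLaws_add`**: `AveragingLaws` data add (sizes and sandwiched pairings add);
 * **`perturbationLaws_gram_rate`**: row B3.b's target shape at rate `ρ ≥ L⁻¹` for the Gram perturbation `a·((B + E)ᴴ(B + E) − BᴴB)` of the free inner averaging by ANY transport error `E`
   with an `AveragingLaws` datum of size `ε` and pairing `Cδ·ρ^k` (`CovariantTableTower.perturbationLaws_avgPertT_rate` is the instance `E = E(T)`; same constants `kappaQ`, `C2gram`);
 * **`avgPertFull`** = `a·((B_k + E_k(T) + E″_k)ᴴ(B_k + E_k(T) + E″_k) − B_kᴴB_k)` — print's `Q*(U)aQ(U) − aQ*Q⊗1` with the FULL linearised averaging (main term table `T` + remainder error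
   `E″`), `avgPertFull_zero` (at `E″ = 0` it is W1's `avgPertT`);
 * **`composed_averaging_remainder_rate`**: file 5's END `ComposedAveragingRate.composed_averaging_rate` with `avgPertFull (TBal W) E″` in the B3 slot — ONE MORE displayed binder
   `hRem : AveragingLaws (Δ_a⊗1) E″ (J⊗1) r (k ↦ C_r·ρ^k)` (the remainder's size — print's (139) — and its two-level consistency — NE3-type), everything else as in file 5.
With this the dictionary-B0 residual r2 is reduced to NAMED DATA LETTERS only: the three letters on the averaged fields `W` (file 5) and the two laws of the remainder error `E″`; what the
tree does NOT do is CONSTRUCT `E″` from (124) (the display of (124) is garbled in the held OCR layer — a page render is a recorded reading task — and its `g`-functions are [B7] §A objects,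
untyped: DIVERGENCE F6 (ζ)).
HONEST FRAMING (T4-DAG p. 1).  MODEL LEVEL; `W`, `E″`, `R`, `P₄` and every letter on them are DISPLAYED hypotheses asserted by nobody; node NE3's `LocalRate` consumed BY NAME (OPEN); NOT
NE2, NOT [B9] (3.16)/(3.26) or [B7] (124) as printed; **NE2 (U1a) NOT PROVED**; spine PROVED 0/9 unchanged; NOT continuum YM / infinite volume / mass gap / Clay.  HONEST DEPENDENCY:
continuum YM on T⁴ ⇐ BetaPertH ∧ nine spine estimates (0/9 proved); BetaPertH ⇐ (D1) ∧ (D4) ∧ CAP+tail; G-an2-4 gates asym, D1 and NE2/3/4.  No `sorry`.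
-/

noncomputable section

open scoped BigOperators ComplexConjugate Matrix Matrix.Norms.L2Operator Kronecker

namespace Summit.QuantumFields.BalabanUV.T4Continuum.NE2.ComposedAveragingRemainder

open Literature.MathematicalPhysics.QuantumFieldTheory.Balaban1983to89.B5Prop11Plancherel (Tor fine Cst Cst_nonneg)
open Literature.MathematicalPhysics.QuantumFieldTheory.Balaban1983to89.B5G183RateUnitTower (lev)
open Literature.MathematicalPhysics.QuantumFieldTheory.Balaban1983to89.T4EtaRateMin (LocalRate)
open Summit.QuantumFields.BalabanUV.T4Continuum
open Summit.QuantumFields.BalabanUV.T4Continuum.BalabanAveragedTowerUnit (idx Qlev)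
open Summit.QuantumFields.BalabanUV.T4Continuum.KingPairingPlantedLaw (JpcT calDalev CJ CJ_nonneg)
open Summit.QuantumFields.BalabanUV.T4Continuum.GramPerturbationLaw (AveragingLaws gramPert C2gram perturbationLaws_gramPert e2gram_le_geom)
open Summit.QuantumFields.BalabanUV.T4Continuum.CovariantAveragingTower (TowerLimitRate)
open Summit.QuantumFields.BalabanUV.T4Continuum.BackgroundResolventTower (PerturbationLaws Cpert)
open Summit.QuantumFields.BalabanUV.T4Continuum.PerturbationAlgebra (perturbationLaws_mono)
open Summit.QuantumFields.BalabanUV.T4Continuum.KroneckerLift (freeTowerLaws_kron)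
open Summit.QuantumFields.BalabanUV.T4Continuum.NE2PerturbedLayer (freeTowerLaws_king)
open Summit.QuantumFields.BalabanUV.T4Continuum.NE2ColourPerturbedLayer (opNorm_inv_calDalev_kron_le)
open Summit.QuantumFields.BalabanUV.T4Continuum.LineAveragingPairing (averagingLaws_Bfree)
open Summit.QuantumFields.BalabanUV.T4Continuum.CovariantBlockAveraging (Bfree)
open Summit.QuantumFields.BalabanUV.T4Continuum.RegularBackgroundTower (RegularTransporters regClass perturbationLaws_covariantLaplacian_of_regular)
open Summit.QuantumFields.BalabanUV.T4Continuum.NE2FromNE3 (bgReadings)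
open Summit.QuantumFields.BalabanUV.T4Continuum.CovariantAveragingSummand (kappaQ)
open Summit.QuantumFields.BalabanUV.T4Continuum.NE2BalabanLayer (tierBPert kappaB C2B perturbationLaws_add₃)
open Summit.QuantumFields.BalabanUV.T4Continuum.NE2ColourPerturbedLayerRate (perturbationLaws_rate_mono towerLimitRate_perturbed_king_kron_rate)
open Summit.QuantumFields.BalabanUV.T4Continuum.NE2.CovariantTableAveraging (Table)
open Summit.QuantumFields.BalabanUV.T4Continuum.NE2.CovariantTableTower (EcovT avgPertT avgPertT_eq_gramPert)
open Summit.QuantumFields.BalabanUV.T4Continuum.NE2.CovariantTableBalaban (TBal)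
open Summit.QuantumFields.BalabanUV.T4Continuum.NE2.ComposedAveragingMean (thetaZero)
open Summit.QuantumFields.BalabanUV.T4Continuum.NE2.ComposedAveragingRate (averagingLaws_EcovT_TBal C2col_nonneg_of_regular)

variable {d : ℕ}

/-! ## §1 `AveragingLaws` add; the Gram law at rate `ρ` for any transport error -/

section Generic

variable {ι : ℕ → Type*} [∀ k, Fintype (ι k)] [∀ k, DecidableEq (ι k)] {σ : Type*} [Fintype σ] [DecidableEq σ]

/-- **`AveragingLaws` DATA ADD**: sizes and sandwiched two-level pairings of `X + Y` are bounded by the sums. [folklore] -/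
theorem averagingLaws_add {D : (k : ℕ) → Matrix (ι k) (ι k) ℂ} {X Y : (k : ℕ) → Matrix σ (ι k) ℂ} {J : (k : ℕ) → Matrix (ι (k + 1)) (ι k) ℂ}
    {x y : ℝ} {f g : ℕ → ℝ} (hX : AveragingLaws D X J x f) (hY : AveragingLaws D Y J y g) :
    AveragingLaws D (fun k => X k + Y k) J (x + y) (fun k => f k + g k) where
  opNorm_le := fun k => (norm_add_le _ _).trans (add_le_add (hX.opNorm_le k) (hY.opNorm_le k))
  pair_mul_inv_le := fun k => by
    have e : ((X (k + 1) + Y (k + 1)) * J k - (X k + Y k)) * (D k)⁻¹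
        = (X (k + 1) * J k - X k) * (D k)⁻¹ + (Y (k + 1) * J k - Y k) * (D k)⁻¹ := by rw [Matrix.add_mul, add_sub_add_comm, Matrix.add_mul]
    rw [e]
    exact (norm_add_le _ _).trans (add_le_add (hX.pair_mul_inv_le k) (hY.pair_mul_inv_le k))
  inv_mul_pair_le := fun k => by
    have e : (D k)⁻¹ * ((X (k + 1) + Y (k + 1)) * J k - (X k + Y k))ᴴ
        = (D k)⁻¹ * (X (k + 1) * J k - X k)ᴴ + (D k)⁻¹ * (Y (k + 1) * J k - Y k)ᴴ := by
      rw [Matrix.add_mul, add_sub_add_comm, Matrix.conjTranspose_add, Matrix.mul_add]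
    rw [e]
    exact (norm_add_le _ _).trans (add_le_add (hX.inv_mul_pair_le k) (hY.inv_mul_pair_le k))

end Generic

section Tower

variable (L : ℕ) [NeZero L] (M : Fin d → ℕ) [hM : ∀ μ, NeZero (M μ)] {o : Type*} [Fintype o] [DecidableEq o] (a : ℝ) (ha : 0 < a)

include ha in
/-- **ROW B3.b's TARGET SHAPE FOR THE GRAM PERTURBATION BY ANY TRANSPORT ERROR, AT RATE `ρ ≥ L⁻¹`**: an `AveragingLaws (Δ_a⊗1) E (J⊗1) ε (k ↦ Cδ·ρ^k)` datum gives
`PerturbationLaws (Δ_a⊗1) (gramPert a B E) (J⊗1) (kappaQ d a a ε) (k ↦ a·C2gram Cst 1 ε (2dCst) CJ Cst Cδ·ρ^k)` — Gram core + `averagingLaws_Bfree`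
(`CovariantTableTower.perturbationLaws_avgPertT_rate` is the instance `E = E(T)`). [folklore] -/
theorem perturbationLaws_gram_rate {E : (k : ℕ) → Matrix ((Tor M × Fin d) × o) (idx L M k × o) ℂ} {ε Cδ ρ : ℝ} (hε : 0 ≤ ε) (hρ : ((L : ℝ)⁻¹) ≤ ρ)
    (hE : AveragingLaws (fun k => calDalev L M a ha k ⊗ₖ (1 : Matrix o o ℂ)) E (fun k => JpcT L M k ⊗ₖ (1 : Matrix o o ℂ)) ε (fun k => Cδ * ρ ^ k)) :
    PerturbationLaws (fun k => calDalev L M a ha k ⊗ₖ (1 : Matrix o o ℂ)) (gramPert (a : ℂ) (Bfree (o := o) L M) E) (fun k => JpcT L M k ⊗ₖ (1 : Matrix o o ℂ))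
      (kappaQ d a (a : ℂ) ε) (fun k => a * C2gram (Cst d a) 1 ε (2 * d * Cst d a) (CJ d a) (Cst d a) Cδ * ρ ^ k) := by
  have h := perturbationLaws_gramPert (freeTowerLaws_kron o (freeTowerLaws_king L M a ha)) (opNorm_inv_calDalev_kron_le L M a ha)
    (averagingLaws_Bfree L M a ha) hE (a : ℂ)
  have hna : ‖(a : ℂ)‖ = a := by rw [Complex.norm_real, Real.norm_of_nonneg ha.le]
  have hL0 : (0 : ℝ) ≤ (L : ℝ)⁻¹ := inv_nonneg.mpr (Nat.cast_nonneg L)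
  have hpow : ∀ k : ℕ, ((L : ℝ)⁻¹) ^ k ≤ ρ ^ k := fun k => pow_le_pow_left₀ hL0 hρ k
  refine perturbationLaws_mono h (le_of_eq ?_) fun k => ?_
  · rw [kappaQ]; ring
  · refine (mul_le_mul_of_nonneg_left (e2gram_le_geom (ρ := ρ) (C₀ := 2 * d * Cst d a) (C₁ := CJ d a) (Cf := Cst d a) (Cδ := Cδ)
      (Cst_nonneg d a) zero_le_one hε
      (fun k => mul_le_mul_of_nonneg_left (hpow k) (by positivity [Cst_nonneg d a]))
      (fun k => mul_le_mul_of_nonneg_left (hpow k) (CJ_nonneg d a))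
      (fun k => mul_le_mul_of_nonneg_left (hpow k) (Cst_nonneg d a)) (fun k => le_rfl) k) (norm_nonneg _)).trans (le_of_eq ?_)
    rw [hna]; ring

/-! ## §2 The full averaging summand: main-term table plus remainder error -/

/-- **PRINT's `Q*(U)aQ(U) − aQ*Q⊗1` WITH THE FULL LINEARISED AVERAGING** — main-term table `T` (composed (125)) plus a REMAINDER transport error `E″` ((124)'s `Q″`, scaled by `√(n_k^d)`):
`a·((B_k + E_k(T) + E″_k)ᴴ(B_k + E_k(T) + E″_k) − B_kᴴB_k)`. [cite: Balaban1985Averaging, (124)–(125) p.36, (139)–(140) p.39 (shape); Balaban1985BackgroundPropagators, (3.16) p.393, (3.26) p.395 (shape)] [folklore] -/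
def avgPertFull (T : (k : ℕ) → Table d (lev L k) M o) (Erem : (k : ℕ) → Matrix ((Tor M × Fin d) × o) (idx L M k × o) ℂ) (k : ℕ) :
    Matrix (idx L M k × o) (idx L M k × o) ℂ :=
  gramPert (a : ℂ) (Bfree (o := o) L M) (fun k => EcovT L M T k + Erem k) k

omit [NeZero L] in
/-- **AT ZERO REMAINDER THE FULL SUMMAND IS W1's TABLE SUMMAND** `avgPertT T`. [folklore] -/
theorem avgPertFull_zero (T : (k : ℕ) → Table d (lev L k) M o) : avgPertFull L M a T (fun _ => 0) = avgPertT L M a T := by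
  rw [avgPertT_eq_gramPert]
  unfold avgPertFull
  simp only [add_zero]

include ha in
/-- **THE FULL SUMMAND IN THE TARGET SHAPE** from the table's `E`-datum and the remainder's datum (both at rate `ρ ≥ L⁻¹`): sizes and pairings ADD. [folklore] -/
theorem perturbationLaws_avgPertFull {T : (k : ℕ) → Table d (lev L k) M o} {Erem : (k : ℕ) → Matrix ((Tor M × Fin d) × o) (idx L M k × o) ℂ}
    {ε Cδ r Cr ρ : ℝ} (hε : 0 ≤ ε) (hr : 0 ≤ r) (hρ : ((L : ℝ)⁻¹) ≤ ρ)
    (hE : AveragingLaws (fun k => calDalev L M a ha k ⊗ₖ (1 : Matrix o o ℂ)) (EcovT L M T) (fun k => JpcT L M k ⊗ₖ (1 : Matrix o o ℂ)) ε (fun k => Cδ * ρ ^ k))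
    (hRem : AveragingLaws (fun k => calDalev L M a ha k ⊗ₖ (1 : Matrix o o ℂ)) Erem (fun k => JpcT L M k ⊗ₖ (1 : Matrix o o ℂ)) r (fun k => Cr * ρ ^ k)) :
    PerturbationLaws (fun k => calDalev L M a ha k ⊗ₖ (1 : Matrix o o ℂ)) (avgPertFull L M a T Erem) (fun k => JpcT L M k ⊗ₖ (1 : Matrix o o ℂ))
      (kappaQ d a (a : ℂ) (ε + r)) (fun k => a * C2gram (Cst d a) 1 (ε + r) (2 * d * Cst d a) (CJ d a) (Cst d a) (Cδ + Cr) * ρ ^ k) := by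
  have hsum : AveragingLaws (fun k => calDalev L M a ha k ⊗ₖ (1 : Matrix o o ℂ)) (fun k => EcovT L M T k + Erem k) (fun k => JpcT L M k ⊗ₖ (1 : Matrix o o ℂ))
      (ε + r) (fun k => (Cδ + Cr) * ρ ^ k) := by
    have h := averagingLaws_add (averagingLaws_EcovT_or hE) hRem
    exact CovariantBlockAveraging.averagingLaws_mono h fun k => le_of_eq (by ring)
  exact perturbationLaws_gram_rate L M a ha (add_nonneg hε hr) hρ hsum
where
  /-- (identity coercion of the table datum to the lambda form) -/
  averagingLaws_EcovT_or {T : (k : ℕ) → Table d (lev L k) M o} {ε : ℝ} {g : ℕ → ℝ}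
      (hE : AveragingLaws (fun k => calDalev L M a ha k ⊗ₖ (1 : Matrix o o ℂ)) (EcovT L M T) (fun k => JpcT L M k ⊗ₖ (1 : Matrix o o ℂ)) ε g) :
      AveragingLaws (fun k => calDalev L M a ha k ⊗ₖ (1 : Matrix o o ℂ)) (fun k => EcovT L M T k) (fun k => JpcT L M k ⊗ₖ (1 : Matrix o o ℂ)) ε g := hE

/-! ## §3 The END with the full averaging term -/

include ha in
/-- **ROOT B ∘ TIER B WITH PRINT's FULL LINEARISED COMPOSED AVERAGING (main term + (124)'s remainder), AT RATE `ρ`** (`L ≥ 2`, `d ≥ 1`, `max(θ_c, 3/(2L)) ≤ ρ < 1`, `t = 1`):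
file 5's `composed_averaging_rate` with `avgPertFull (k ↦ TBal (W^{(k)}) k) E″` in the B3 slot — binders: rows B5/NE3 (`hreg`, `hNE3` BY NAME), the three data letters on the averaged
fields `W`, the REMAINDER's two laws `hRem : AveragingLaws (Δ_a⊗1) E″ (J⊗1) r (k ↦ C_r·ρ^k)` (size — print's (139) «≤ C₁L²α₀» — and two-level consistency — NE3-type; `E″` is DATA, not
constructed from (124)), the fourth-slot law at rate `ρ`, and the threshold `κ_B < 1`.  NE2 NOT proved. [cite: Balaban1985Averaging, (124)–(125) p.36, (139)–(143) p.39 (shape);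
Balaban1985BackgroundPropagators, (3.15)–(3.16) p.393, (3.26) p.395 (shape); King1986, Lemma 4.5 (4.32)/(4.38) p.674 (template)] [folklore] -/
theorem composed_averaging_remainder_rate [Nonempty o] (hL : 2 ≤ L) (hd : 1 ≤ d) {R : (k : ℕ) → Fin d → (idx L M k → Matrix o o ℂ)} {αR βR : ℝ}
    (hreg : RegularTransporters L M R αR βR) {C : ℝ} (hC : 0 ≤ C) (hNE3 : LocalRate (bgReadings L M (regClass L M R)) C ((L : ℝ)⁻¹))
    {W : ℕ → (i : ℕ) → Fin d → (idx L M i → Matrix o o ℂ)} {α σ θc ρ : ℝ}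
    (hα : 0 ≤ α) (hσ : 0 ≤ σ) (hθ0 : 0 ≤ θc) (hθ1 : θc ≤ 1) (hθρ : θc ≤ ρ) (hρ : 3 / (2 * (L : ℝ)) ≤ ρ) (hρ1 : ρ < 1)
    (hWn : ∀ k i ν b, ‖W k i ν b‖ ≤ 1) (hWa : ∀ k i ν b, ‖W k i ν b - 1‖ ≤ α / (lev L i : ℕ))
    (hWc : ∀ k i ν b, i ≤ k → ‖W (k + 1) i ν b - W k i ν b‖ ≤ σ * θc ^ k / (lev L i : ℕ))
    {Erem : (k : ℕ) → Matrix ((Tor M × Fin d) × o) (idx L M k × o) ℂ} {r Cr : ℝ} (hr : 0 ≤ r)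
    (hRem : AveragingLaws (fun k => calDalev L M a ha k ⊗ₖ (1 : Matrix o o ℂ)) Erem (fun k => JpcT L M k ⊗ₖ (1 : Matrix o o ℂ)) r (fun k => Cr * ρ ^ k))
    {P₄ : (k : ℕ) → Matrix (idx L M k × o) (idx L M k × o) ℂ} {κ₄ C₄ : ℝ}
    (hP₄ : PerturbationLaws (fun k => calDalev L M a ha k ⊗ₖ (1 : Matrix o o ℂ)) P₄ (fun k => JpcT L M k ⊗ₖ (1 : Matrix o o ℂ)) κ₄ (fun k => C₄ * ρ ^ k))
    (hsmall : kappaB o d a αR βR C (kappaQ d a (a : ℂ) (Fintype.card o * (Real.exp ((((d + 1) * L : ℕ) : ℝ) * α) - 1) + r)) κ₄ < 1) :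
    TowerLimitRate (fun k => Qlev L M k ⊗ₖ (1 : Matrix o o ℂ)) ((L : ℝ) ^ d)
      (fun k => (calDalev L M a ha k ⊗ₖ (1 : Matrix o o ℂ) + tierBPert L M R (avgPertFull L M a (fun k => TBal L M (W k) k) Erem) P₄ k)⁻¹)
      (Cpert (kappaB o d a αR βR C (kappaQ d a (a : ℂ) (Fintype.card o * (Real.exp ((((d + 1) * L : ℕ) : ℝ) * α) - 1) + r)) κ₄) (2 * d * Cst d a) (CJ d a)
        (C2B o d L a αR βR C
          (a * C2gram (Cst d a) 1 (Fintype.card o * (Real.exp ((((d + 1) * L : ℕ) : ℝ) * α) - 1) + r) (2 * d * Cst d a) (CJ d a) (Cst d a)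
            (Cst d a * Fintype.card o * (thetaZero d L α σ + (Real.exp ((((d + 1) * L : ℕ) : ℝ) * α) - 1)) + Cr)) C₄) 0 1) ρ := by
  have hL1 : 1 ≤ L := by omega
  have hLr : (1 : ℝ) ≤ L := by exact_mod_cast hL1
  have hρL : ((L : ℝ)⁻¹) ≤ ρ := by
    refine le_trans ?_ hρ
    rw [div_eq_mul_inv, mul_inv, ← mul_assoc]
    have : (0 : ℝ) ≤ (L : ℝ)⁻¹ := inv_nonneg.mpr (by linarith)
    nlinarith
  have hτ : 0 ≤ Fintype.card o * (Real.exp ((((d + 1) * L : ℕ) : ℝ) * α) - 1) := by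
    have : 0 ≤ Real.exp ((((d + 1) * L : ℕ) : ℝ) * α) - 1 := by
      linarith [Real.add_one_le_exp ((((d + 1) * L : ℕ) : ℝ) * α), (by positivity : (0 : ℝ) ≤ (((d + 1) * L : ℕ) : ℝ) * α)]
    positivity
  have hP₃ := perturbationLaws_avgPertFull L M a ha hτ hr hρL (averagingLaws_EcovT_TBal L M a ha hL hα hσ hθ0 hθ1 hθρ hρ hWn hWa hWc) hRem
  have hP₁ := perturbationLaws_rate_mono L (C2col_nonneg_of_regular L M a ha hd hreg hC hNE3) hρL
    (perturbationLaws_covariantLaplacian_of_regular L M a ha hd hreg hC hNE3)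
  have hsum := perturbationLaws_add₃ hP₁ hP₃ hP₄
  have h := towerLimitRate_perturbed_king_kron_rate L M a ha hρL hρ1 hsum (t := 1) (by rw [norm_one, one_mul]; exact hsmall)
  simpa only [one_smul, tierBPert, kappaB, C2B] using h

end Tower

end Summit.QuantumFields.BalabanUV.T4Continuum.NE2.ComposedAveragingRemainder

end
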